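import Summits.BirchSwinnertonDyer.BirchSwinnertonDyer.Theorems.AlignedTransportAtTwoMainConjectureOfRankZeroBSDAtTwoCubicLayerOneUnitDoor
import Literature.NumberTheory.IwasawaTheory.ClassGroupPRankLeOneOfAmbiguousLayerTwo
import HarnessLib

/-!
# Route `AlignedTransportAtTwo`, crux C2 `MainConjectureOfRankZeroBSDAtTwo` (stmt-BirchSwinnertonDyer-22298):
# THE DEPTH DOOR INTO `MC₂(W)` — when the layer-one doors are void (`e₁ = 1`, every unit of `ℚ(β,√2)` a norm), Chevalley's count for the cyclic
# QUARTIC layer `ℚ(β) ⊂ K_2` (two ramified primes, `−1` and `ε` norms from `K_2`) together with `ord₂ h(K_1) ≤ 1` gives `rank₂ Cl(K_m) ≤ 1` for all `m`,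
# `μ₂ = 0`, `λ₂ ≤ 1` for the cubic field, hence `MC₂(W)`

HONEST FRAMING (cell `bsd-f1-sign2`, WIDTH-5 attached prover seat `bsd-line-att-p3` gen 42 on line `birth` of the lead `bsd-line-att-p2`;
`--supports` stmt-BirchSwinnertonDyer-22298, closes nothing; BSD is NOT proved by any of this; the crux C2, its verdict «blocked-on
`Rank1Residual.GreenbergMuConjectureIrreducible`» and every registered stub are untouched).  THEOREMS ONLY — no definition, no named fact, no `sorry`.

WHY.  On the off-stratum sub-cell `Δ_min ≡ 5 (mod 8)` (`2 = 𝔭₁𝔭₂` in `K = ℚ(β)`, `h(K)` odd) with `σ₁(ε) ≡ ±1 (mod 16)` NO door of the tree fires: Chevalley's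
door at `K → K_1 = K(√2)` is void (`ε` is a dyadic norm, `e₁ ≥ 1`), and so is the layer-one unit door (att-p3 g41 `…CubicLayerOneUnitDoor`: every unit of `K_1` is
a norm from `K_2`, `e₂ ≥ e₁ + 1`).  The DEPTH DOOR (Literature `IwasawaTheory/ClassGroupPRankLeOneOfAmbiguousLayerTwo`, this seat) reads Chevalley's formula for the
cyclic QUARTIC layer `K_2/K` instead: if at least two primes of `K` ramify in `K_2` and `[E_K : E_K ∩ N_{K_2/K} K_2ˣ] = 1` (for a complex cubic field
`E_K = ⟨−1, ε⟩`: two norm identities in `K_2 = K(θ)`, `θ⁴ − 4θ² + 2 = 0`) then `4 ∣ #Cl(K_2)^{Gal(K_2/K)}`, and with `2 ∤ h_K`, `ord₂ h(K_1) ≤ 1` Washington's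
`X = Λ/J` is cyclic with `v₂(j(−2)) = 1`, `J(0) ⊆ 4ℤ₂`, whence `X/2X = 𝔽₂`: `rank₂ Cl(K_m) ≤ 1` for every `m`, `μ₂ = 0`, `λ₂ ≤ 1`.

WHAT.
* **`classGroupPRank_le_one_adjoin_of_depthDoor`** — `W` globally minimal, good ordinary at `2`, no rational `2`-torsion abscissa, `β` a root of the `2`-division
  cubic, `κ` a cyclotomic `ℤ₂`-extension of `ℚ(β)` (Fukuda index `0`, att-p5 g28 `totallyRamifiedFrom_zero_adjoin_of_isOrdinaryAt_two`); displayed: `h(ℚ(β))` odd,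
  `ord₂ h(K_1) ≤ 1`, at least two primes of `ℚ(β)` ramified in `K_2`, `[E_{ℚ(β)} : E_{ℚ(β)} ∩ N_{K_2/ℚ(β)} K_2ˣ] = 1` ⟹ `rank₂ Cl(K_m) ≤ 1` for all `m`, `μ₂ = 0`,
  `λ₂ ≤ 1`.
* **`mazurMainConjecture_two_of_muIneqRel_of_depthDoor`** — PRINT⁵ {Kato 17.4 (1)(2) at `2`, Greenberg 4.1, period unit, modularity, GZK} + MuIneqʳ (registered
  stub verbatim) + the cell hypotheses (`Δ_W < 0`, `r_an = 0`, analytic `μ₂ = 0`, `BSD₂(W)`) + the same displayed data for every cyclotomic `κ` ⟹ `MC₂(W)`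
  (att-p5 g24's cubic carrier road `mazurMainConjecture_two_of_muIneqRel_of_classicalMu_cubicField_of_Δ_neg`).

CONDITIONAL theorems (PRINT⁵, MuIneqʳ displayed); nothing is asserted about any curve's class numbers or units (the census of the crux memo
`LAYER-ONE-UNIT-DOOR-att-p3-g41.md` §8 names the candidate seeds: `u1/u7` with `σ₁(π₁)/2 ≡ ±3 (8)`); nothing is closed; BSD is not proved.

References: [Washington1997] §13.3 Lemmas 13.15, 13.18, Prop. 13.22–13.23; [Lang1990] Ch. 13 §4, Lemma 4.1; [Fukuda1994] Thm. 1, p. 264; [NeukirchANT1999]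
Ch. IV §6, Ch. VI §7 Thm. (7.1); [Kato2004Asterisque] Thm. 17.4 (1)(2) (p. 273); [GreenbergLNM1716] Thm. 4.1 (p. 102), Conj. 1.11 (p. 58); tree: att-p5 g24
`…CubicCarrierRoad`, g28 `…CubicOffStratumFukudaIndex`; this seat's Literature files `IwasawaTheory/FukudaDepthAlgebra`, `IwasawaTheory/Fukuda1994Thm1RankPackageFixed`,
`IwasawaTheory/ClassGroupPRankLeOneOfAmbiguousLayerTwo`.
-/

set_option linter.dupNamespace false
set_option autoImplicit false

noncomputable section

open scoped Classical NumberField nonZeroDivisors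

namespace Summit.BirchSwinnertonDyer.BirchSwinnertonDyer.Theorems.AlignedTransportAtTwoCubicDepthDoor

open NumberField IsDedekindDomain Polynomial WeierstrassCurve IntermediateField CongruenceSubgroup
  Literature.NumberTheory.IwasawaTheory Literature.NumberTheory.GaloisRepresentations
  Literature.NumberTheory.GaloisRepresentations.Herbrand Literature.NumberTheory.GaloisRepresentations.MinkowskiUnit
  Literature.NumberTheory.GaloisRepresentations.CyclicNormIndex
  Literature.NumberTheory.EllipticCurves Literature.NumberTheory.EllipticCurves.Greenberg1999
  Literature.NumberTheory.EllipticCurves.ModularForms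
  Literature.NumberTheory.EllipticCurves.Rank1Residual
  Literature.NumberTheory.EllipticCurves.Module
  Summit.BirchSwinnertonDyer.Rank1Residual
  Summit.BirchSwinnertonDyer.Rank1Residual.X1.MuLambda
  Summit.BirchSwinnertonDyer.Rank1Residual.X5
  Summit.BirchSwinnertonDyer.Rank1Residual.F1Sign2
  Summit.BirchSwinnertonDyer.BirchSwinnertonDyer.Theorems.Rank1ResidualX1Defs
  Summit.BirchSwinnertonDyer.BirchSwinnertonDyer.Theses.AlignedTransportAtTwo
  Summit.BirchSwinnertonDyer.BirchSwinnertonDyer.Theorems.AlignedTransportAtTwoKilfordStratumShared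
  Summit.BirchSwinnertonDyer.BirchSwinnertonDyer.Theorems.AlignedTransportAtTwoCubicCarrierRoad
  Summit.BirchSwinnertonDyer.BirchSwinnertonDyer.Theorems.AlignedTransportAtTwoCubicOffStratumFukudaIndex

variable (W : WeierstrassCurve ℚ) [W.IsElliptic] [W.IsGloballyMinimal]

/-! ## §1 `rank₂ ≤ 1`, `μ₂ = 0`, `λ₂ ≤ 1` for the cubic `2`-torsion field from the depth door -/

/-- **`rank₂ Cl(K_m) ≤ 1` FOR EVERY `m`, `μ₂(ℚ(β)^{cyc}) = 0` AND `λ₂ ≤ 1` FROM THE DEPTH DOOR.**  `W/ℚ` globally minimal, good ordinary at `2`, no rational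
`2`-torsion abscissa, `β ∈ ℚ̄` a root of the `2`-division cubic, `κ` a cyclotomic `ℤ₂`-extension of `ℚ(β)` (Fukuda index `0`, att-p5 g28); displayed:
`h(ℚ(β))` odd, `ord₂ h(K_1) ≤ 1`, at least two primes of `ℚ(β)` ramified in the layer `K_2`, and `[E_{ℚ(β)} : E_{ℚ(β)} ∩ N_{K_2/ℚ(β)} K_2ˣ] = 1` inside `K_2ˣ`
(every unit of `ℚ(β)` is a norm from the quartic layer).  THEN `rank₂ Cl(K_m) ≤ 1` for all `m`, `μ₂(κ) = 0`, `λ₂(κ) ≤ 1` (Literature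
`classGroupPRank_le_one_of_relIndex_unitsNorm_eq_one`). [cite: Washington1997, §13.3 Prop. 13.22–13.23] [cite: Lang1990, Ch. 13 §4, Lemma 4.1 (PDF pp. 203–204)]
[cite: Fukuda1994, Thm. 1, p. 264] [cite: NeukirchANT1999, Ch. IV §6 and Ch. VI §7 Thm. (7.1)] -/
theorem classGroupPRank_le_one_adjoin_of_depthDoor (hord : IsOrdinaryAt W 2)
    (ht : ∀ x : ℚ, ¬ HasRationalTwoTorsionX W x)
    {β : AlgebraicClosure ℚ} (hβ : aeval β W.twoTorsionPolynomial.toPoly = 0)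
    (hh : haveI : FiniteDimensional ℚ ↥(IntermediateField.adjoin ℚ ({β} : Set (AlgebraicClosure ℚ))) :=
        IntermediateField.adjoin.finiteDimensional ((AlgebraicClosure.isAlgebraic ℚ).isAlgebraic β).isIntegral
      haveI : NumberField ↥(IntermediateField.adjoin ℚ ({β} : Set (AlgebraicClosure ℚ))) := NumberField.mk
      ¬ 2 ∣ classNumber ↥(IntermediateField.adjoin ℚ ({β} : Set (AlgebraicClosure ℚ))))
    (κP : ZpExtension ↥(IntermediateField.adjoin ℚ ({β} : Set (AlgebraicClosure ℚ))) 2) (hκP : κP.IsCyclotomic)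
    [FiniteDimensional ↥(IntermediateField.adjoin ℚ ({β} : Set (AlgebraicClosure ℚ))) (κP.layer 2)] [NumberField (κP.layer 2)]
    (he1 : classNumberPExp κP 1 ≤ 1)
    (hs : 2 ≤ {v : HeightOneSpectrum (𝓞 ↥(IntermediateField.adjoin ℚ ({β} : Set (AlgebraicClosure ℚ)))) |
        v.asIdeal.ramificationIdxIn (𝓞 (κP.layer 2)) ≠ 1}.ncard)
    (hidx : (unitsE (κP.layer 2) ⊓ (⊤ : Subgroup (κP.layer 2)ˣ).map
        (Herbrand.norm ((κP.layer 2) ≃ₐ[↥(IntermediateField.adjoin ℚ ({β} : Set (AlgebraicClosure ℚ)))] (κP.layer 2)))).relIndex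
        (unitsE (κP.layer 2) ⊓ (unitsIncl ↥(IntermediateField.adjoin ℚ ({β} : Set (AlgebraicClosure ℚ))) (κP.layer 2)).range) = 1) :
    (∀ m : ℕ, classGroupPRank κP m ≤ 1) ∧ ClassicalMuVanishes κP ∧ classicalLambda κP ≤ 1 := by
  have hβint : IsIntegral ℚ β := ((AlgebraicClosure.isAlgebraic ℚ).isAlgebraic β).isIntegral
  haveI : FiniteDimensional ℚ ↥(IntermediateField.adjoin ℚ ({β} : Set (AlgebraicClosure ℚ))) :=
    IntermediateField.adjoin.finiteDimensional hβint
  haveI : NumberField ↥(IntermediateField.adjoin ℚ ({β} : Set (AlgebraicClosure ℚ))) := NumberField.mk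
  have hram := totallyRamifiedFrom_zero_adjoin_of_isOrdinaryAt_two W hord ht hβ κP hκP
  exact classGroupPRank_le_one_of_relIndex_unitsNorm_eq_one κP hram hh he1 hs hidx

/-! ## §2 The door into `MC₂(W)` -/

/-- **THE DEPTH DOOR INTO `MC₂(W)`.**  PRINT⁵ {Kato 17.4 (1)(2) at `2` (`h17`), Greenberg 4.1 (`hGr`), period unit (`hper`), modularity (`hmod`), GZK (`hGZK`)}
+ MuIneqʳ (`hI`, the registered stub VERBATIM) + the cell hypotheses (good ordinary at `2`, no rational `2`-torsion abscissa, `Δ_W < 0`, `r_an = 0`, analytic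
`μ₂ = 0` on the even branch, `BSD₂(W)`) + `β` a root of the `2`-division cubic + the displayed data of `ℚ(β)`: `h(ℚ(β))` odd and, for every cyclotomic
`ℤ₂`-extension `κ` of `ℚ(β)`, `ord₂ h(K_1) ≤ 1`, at least two primes of `ℚ(β)` ramified in `K_2`, `[E_{ℚ(β)} : E_{ℚ(β)} ∩ N_{K_2/ℚ(β)} K_2ˣ] = 1` ⟹ `MC₂(W)`
(att-p5 g24's cubic carrier road ∘ §1).  Aimed at the `u1/u7` seeds of the sub-cell `Δ_min ≡ 5 (mod 8)` where both layer-one doors are void.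
[cite: Fukuda1994, Thm. 1, p. 264] [cite: Kato2004Asterisque, Thm. 17.4 (1)(2) (p. 273)] [cite: GreenbergLNM1716, Thm. 4.1 (p. 102) and Conj. 1.11 (p. 58)]
[cite: Lang1990, Ch. 13 §4, Lemma 4.1 (PDF pp. 203–204)] [cite: Washington1997, §13.3 Prop. 13.22–13.23] -/
theorem mazurMainConjecture_two_of_muIneqRel_of_depthDoor
    (h17 : ∀ [NeZero (W.conductorNorm ℤ)] (f : CuspForm (Gamma0 (W.conductorNorm ℤ)) 2),
      kato_divisibility_allPrimes W 2 (f := f))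
    (hGr : Greenberg1999.thm41_charValue_rankZero_anyPrime)
    (hper : realPeriodRat_eq_unit_mul_plusPeriod_two) (hmod : nonempty_modularParametrizationData)
    (hGZK : rank_eq_analyticRank_of_analyticRank_le_one)
    (hI : ∀ (W : WeierstrassCurve ℚ) [W.IsElliptic] [W.IsGloballyMinimal], IsOrdinaryAt W 2 →
      (∀ x : ℚ, ¬ HasRationalTwoTorsionX W x) →
      ∀ (κ : ZpExtension ℚ 2) (γ : Field.absoluteGaloisGroup ℚ), κ.IsCyclotomic →
      κ.IsTopGenerator γ → IsCyclotomicVariable 2 γ →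
      ∀ ⦃N : ℕ⦄ [NeZero N] (f : CuspForm (Gamma0 N) 2), IsNewformOf W f →
      ∀ Gp : IwasawaAlgebra 2, iwasawaToPowerSeries 2 Gp = padicLFunction f (unitRoot W 2 : ℚ_[2]) →
      ∀ (D : W.SelmerDualData κ γ) (Yr : W.FineSelmerDualDataRelaxedInf κ γ),
        lengthAt (IwasawaAlgebra 2) D.X ⟨IwasawaAlgebra.augIdealP 2, IwasawaAlgebra.isPrime_augIdealP_holds 2⟩ ≤
          lengthAt (IwasawaAlgebra 2) (IwasawaAlgebra 2 ⧸ Ideal.span {Gp})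
              ⟨IwasawaAlgebra.augIdealP 2, IwasawaAlgebra.isPrime_augIdealP_holds 2⟩ +
            lengthAt (IwasawaAlgebra 2) Yr.X ⟨IwasawaAlgebra.augIdealP 2, IwasawaAlgebra.isPrime_augIdealP_holds 2⟩)
    (hord : IsOrdinaryAt W 2) (ht : ∀ x : ℚ, ¬ HasRationalTwoTorsionX W x) (hΔ : W.Δ < 0) (hr : W.analyticRank = 0)
    (hμan : ∀ ⦃N : ℕ⦄ [NeZero N] (f : CuspForm (Gamma0 N) 2), IsNewformOf W f →
      ∀ G : IwasawaAlgebra 2, IsEvenBranchLiftAtTwo W f G → red G ≠ 0)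
    (hbsd : BSDp W 2)
    {β : AlgebraicClosure ℚ} (hβ : aeval β W.twoTorsionPolynomial.toPoly = 0)
    (hh : haveI : FiniteDimensional ℚ ↥(IntermediateField.adjoin ℚ ({β} : Set (AlgebraicClosure ℚ))) :=
        IntermediateField.adjoin.finiteDimensional ((AlgebraicClosure.isAlgebraic ℚ).isAlgebraic β).isIntegral
      haveI : NumberField ↥(IntermediateField.adjoin ℚ ({β} : Set (AlgebraicClosure ℚ))) := NumberField.mk
      ¬ 2 ∣ classNumber ↥(IntermediateField.adjoin ℚ ({β} : Set (AlgebraicClosure ℚ))))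
    (hdepth : ∀ (κP : ZpExtension ↥(IntermediateField.adjoin ℚ ({β} : Set (AlgebraicClosure ℚ))) 2)
      [FiniteDimensional ↥(IntermediateField.adjoin ℚ ({β} : Set (AlgebraicClosure ℚ))) (κP.layer 2)] [NumberField (κP.layer 2)],
      κP.IsCyclotomic →
        classNumberPExp κP 1 ≤ 1 ∧
        2 ≤ {v : HeightOneSpectrum (𝓞 ↥(IntermediateField.adjoin ℚ ({β} : Set (AlgebraicClosure ℚ)))) |
            v.asIdeal.ramificationIdxIn (𝓞 (κP.layer 2)) ≠ 1}.ncard ∧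
        (unitsE (κP.layer 2) ⊓ (⊤ : Subgroup (κP.layer 2)ˣ).map
            (Herbrand.norm ((κP.layer 2) ≃ₐ[↥(IntermediateField.adjoin ℚ ({β} : Set (AlgebraicClosure ℚ)))] (κP.layer 2)))).relIndex
          (unitsE (κP.layer 2) ⊓ (unitsIncl ↥(IntermediateField.adjoin ℚ ({β} : Set (AlgebraicClosure ℚ))) (κP.layer 2)).range) = 1) :
    MazurMainConjecture W 2 := by
  have hβint : IsIntegral ℚ β := ((AlgebraicClosure.isAlgebraic ℚ).isAlgebraic β).isIntegral
  haveI : FiniteDimensional ℚ ↥(IntermediateField.adjoin ℚ ({β} : Set (AlgebraicClosure ℚ))) :=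
    IntermediateField.adjoin.finiteDimensional hβint
  haveI : NumberField ↥(IntermediateField.adjoin ℚ ({β} : Set (AlgebraicClosure ℚ))) := NumberField.mk
  refine mazurMainConjecture_two_of_muIneqRel_of_classicalMu_cubicField_of_Δ_neg W h17 hGr hper hmod hGZK hI hord ht hΔ hr hμan hbsd hβ
    fun κP hκP => ?_
  haveI : FiniteDimensional ↥(IntermediateField.adjoin ℚ ({β} : Set (AlgebraicClosure ℚ))) (κP.layer 2) :=
    κP.finiteDimensional_layer_holds 2
  haveI : NumberField (κP.layer 2) := NumberField.of_module_finite ↥(IntermediateField.adjoin ℚ ({β} : Set (AlgebraicClosure ℚ))) _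
  obtain ⟨he1, hs, hidx⟩ := hdepth κP hκP
  exact (classGroupPRank_le_one_adjoin_of_depthDoor W hord ht hβ hh κP hκP he1 hs hidx).2.1

end Summit.BirchSwinnertonDyer.BirchSwinnertonDyer.Theorems.AlignedTransportAtTwoCubicDepthDoor

end
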